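import Literature.NumberTheory.EllipticCurves.OpenImageMazurFrobeniusProofs
import Literature.NumberTheory.EllipticCurves.ModPImageTransvectionCriterionProofs
import HarnessLib

/-!
# BirchSwinnertonDyer — rank ≥ 2 observatory: A HYPOTHESIS-FREE FROBENIUS CERTIFICATE FOR `ρ̄_{E,p}` ONTO `GL₂(𝔽_p)`, II —
# one good prime `ℓ ≠ p` whose Frobenius has a REPEATED EIGENVALUE `c` on `E[p]` (`a_ℓ ≡ 2c`, `ℓ ≡ c²  (mod p)`) and is NOT A
# SCALAR there (`p² ∤ c² − a_ℓ c + ℓ`), given `E[p]` irreducible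

HONEST FRAMING: per-curve certified theorems and census instruments; no claim on BSD in rank ≥ 2.

WHAT.  `hasSurjectiveModNGaloisRep_of_frobenius_eigenvalue` generalises the transvection certificate of
`…ModPTransvectionCertificate` (the case `c = 1`): for an elliptic curve `E = W/ℚ` in global minimal form, a prime `p` with
`E[p]` irreducible, ONE prime `ℓ ≠ p` of good reduction and an integer `c` with `p ∣ ℓ − c²`, `p ∣ a_ℓ − 2c` (the characteristic
polynomial `X² − a_ℓX + ℓ` of `Frob_ℓ` is `(X − c)²  (mod p)`) and `p² ∤ c² − a_ℓ c + ℓ = deg(Frob_ℓ − c) = #ker(Frob_ℓ − c)`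
(so `Frob_ℓ ≠ c` on `E[p]`), the representation `ρ̄_{E,p} : Γ_ℚ → Aut(E[p]) ≅ GL₂(𝔽_p)` is ONTO.  Necessarily `c ≡ a_ℓ/2`, so
the test reads: `a_ℓ² ≡ 4ℓ (mod p)` and `p² ∤ (a_ℓ/2)² − a_ℓ(a_ℓ/2) + ℓ` for a lift of `a_ℓ/2` — decidable from the coefficients.
WHY THE GENERALISATION.  A witness of this kind exists among the good primes with Dirichlet–Chebotarev density `1/p` when `ρ̄` is
onto (the non-semisimple classes), against `1/(p² − p)` for transvections (`c = 1` forces `ℓ ≡ 1`); on the rank-3 table the least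
witness at `p = 5` has mean `30` instead of `116` and at `p = 7` mean `32` instead of `273` (engine scope), which is what makes the
mod-`5` and mod-`7` image censuses affordable inside the kernel with row 56's `O(ℓ)` trace evaluator.
PROOF (all inputs are tree theorems; no named fact is granted).  As in part I: `v` the place at `ℓ`, `σ₀` a Frobenius, Mazur's
injective equivariant reduction map `f : E[p^∞] ↪ Ẽ_v(𝔽̄_ℓ)` (`exists_reduceTorsionHom`) and Manin's relation give
`σ₀²P − a_ℓσ₀P + ℓP = O` on `E[p^∞]`.  (A) On `E[p]`: `(σ₀ − c)² = 0`; with `d = c^{p−2}` (`cd ≡ 1`, Fermat) put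
`N y := d(σ₀y − cy)`; then `σ₀y = c(y + Ny)`, `σ₀(Ny) = c·Ny`, hence `σ₀ⁿ y = cⁿ(y + n·Ny)`.  (B) `σ₀ ≠ c` on `E[p]`: otherwise a
point `P` of order `p²` has `Q := σ₀P − cP ∈ E[p]`, and Manin at `P` reads `(c² − a_ℓc + ℓ)P + (2c − a_ℓ)Q = O`, i.e.
`(c² − a_ℓc + ℓ)P = O`, so `p² ∣ c² − a_ℓc + ℓ` — excluded.  (C) `h := ρ̄(σ₀)^{p−1}` acts on `E[p]` as `y ↦ y − Ny`
(`c^{p−1} ≡ 1`), so `h ≠ 1` by (B) and `h^p = ρ̄(σ₀)^{p(p−1)} = 1`; `h` has order `p` in the image `G`, `p ∣ #G`, and Serre's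
Prop. 15 (`Serre1972.not_dvd_natCard_of_forall_not_le_eigenvectorStabilizer`: irreducible `G ≠ GL₂` with `det G = 𝔽_pˣ` has order
prime to `p`) is contradicted unless `G = GL₂(𝔽_p)`.
USE: rows 67– of the observatory (the mod-`5` / mod-`7` images of `rank3Table`).  NOT CLAIMED: any converse, anything about BSD.
Sources: J.-P. Serre, Invent. Math. 15 (1972) §2.4 Prop. 15; B. Mazur, Invent. Math. 44 (1978) §6; J. H. Silverman, AEC (2009) VII.3.1.
-/

set_option linter.dupNamespace false
set_option autoImplicit false

noncomputable section

open scoped Classical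
open NumberField IsDedekindDomain IsDedekindDomain.HeightOneSpectrum Rat.HeightOneSpectrum Field WeierstrassCurve
open Literature Literature.NumberTheory Literature.NumberTheory.EllipticCurves Literature.NumberTheory.GaloisRepresentations
open Literature.NumberTheory.GaloisRepresentations.Serre1972 Matrix

namespace Summit.BirchSwinnertonDyer.BirchSwinnertonDyer.Rank2Observatory

/-- **Frobenius repeated-eigenvalue certificate for `ρ̄_{E,p}` onto.**  Let `E = W/ℚ` be an elliptic curve in global minimal
form and `p` a prime with `E[p]` irreducible.  If some prime `ℓ ≠ p` of good reduction and some integer `c` satisfy `p ∣ ℓ − c²`,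
`p ∣ a_ℓ − 2c` and `p² ∤ c² − a_ℓ c + ℓ` (so `ρ̄_{E,p}(Frob_ℓ)` has characteristic polynomial `(X − c)²` and is not the
scalar `c`), then `ρ̄_{E,p} : Γ_ℚ → Aut(E[p])` is surjective.  The case `c = 1` is
`hasSurjectiveModNGaloisRep_of_frobenius_transvection`.
[cite: Serre1972, §2.4 Prop. 15] [cite: Mazur1978, §6 Prop. 6.3 (1) and its proof (p. 153)] -/
theorem hasSurjectiveModNGaloisRep_of_frobenius_eigenvalue (W : WeierstrassCurve ℚ) [W.IsElliptic]
    [W.IsGloballyMinimal] (p ℓ : ℕ) [Fact p.Prime] [Fact ℓ.Prime] (c : ℤ)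
    (hirr : W.HasIrreducibleModPGaloisRep p) (hgoodℓ : W.HasGoodReductionAtPrime ℓ) (hℓp : ℓ ≠ p)
    (hc : (p : ℤ) ∣ (ℓ : ℤ) - c ^ 2) (ha : (p : ℤ) ∣ W.frobeniusTrace ℓ - 2 * c)
    (hp2 : ¬ (p : ℤ) ^ 2 ∣ c ^ 2 - W.frobeniusTrace ℓ * c + ℓ) :
    W.HasSurjectiveModNGaloisRep p := by
  have hp : p.Prime := Fact.out
  have hℓ : ℓ.Prime := Fact.out
  haveI : NeZero p := ⟨hp.ne_zero⟩
  -- `p ∤ c` (else `p ∣ ℓ`), Fermat `p ∣ c^{p-1} − 1`, and the inverse `d = c^{p-2}` of `c` modulo `p`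
  have hpc : ¬ (p : ℤ) ∣ c := by
    intro h
    have h2 : (p : ℤ) ∣ (ℓ : ℤ) := by
      have := dvd_add hc (dvd_mul_of_dvd_right h c)
      rwa [pow_two, sub_add_cancel] at this
    exact hℓp ((Nat.prime_dvd_prime_iff_eq hp hℓ).mp (by exact_mod_cast h2)).symm
  have hF : (p : ℤ) ∣ c ^ (p - 1) - 1 := by
    have hc0 : (c : ZMod p) ≠ 0 := fun h ↦ hpc ((ZMod.intCast_zmod_eq_zero_iff_dvd c p).mp h)
    have h1 := ZMod.pow_card_sub_one_eq_one hc0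
    refine (ZMod.intCast_zmod_eq_zero_iff_dvd _ p).mp ?_
    push_cast
    rw [h1, sub_self]
  set d : ℤ := c ^ (p - 2) with hd
  have hcd : (p : ℤ) ∣ c * d - 1 := by
    have h : c * d = c ^ (p - 1) := by
      rw [hd, ← pow_succ']; congr 1; have := hp.two_le; omega
    rwa [h]
  by_contra hns
  -- Step 0: the place `v` of `ℚ` at `ℓ`; `ℓ ∈ v`, `p ∉ v`, good reduction at `v`
  set v : HeightOneSpectrum (𝓞 ℚ) := (primesEquiv (R := 𝓞 ℚ)).symm ⟨ℓ, hℓ⟩ with hvdef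
  have hvℓ : (primesEquiv v : ℕ) = ℓ := by rw [hvdef, Equiv.apply_symm_apply]
  have hgen : ((primesEquiv v : ℕ) : 𝓞 ℚ) ∈ v.asIdeal := by
    have h := (Rat.HeightOneSpectrum.natGenerator_dvd_iff v).mp dvd_rfl
    rwa [← map_natCast (Rat.IsIntegralClosure.intEquiv (𝓞 ℚ)), Ideal.apply_mem_of_equiv_iff] at h
  have hv : (ℓ : 𝓞 ℚ) ∈ v.asIdeal := hvℓ ▸ hgen
  have hpv : (p : 𝓞 ℚ) ∉ v.asIdeal := fun h ↦ by
    have h' := Ideal.mem_map_of_mem (Rat.IsIntegralClosure.intEquiv (𝓞 ℚ)) h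
    rw [map_natCast] at h'
    have hdvd : (primesEquiv v : ℕ) ∣ p := (Rat.HeightOneSpectrum.natGenerator_dvd_iff v).mpr h'
    rw [hvℓ] at hdvd
    exact hℓp ((Nat.prime_dvd_prime_iff_eq hℓ hp).mp hdvd)
  have hgood : W.HasGoodReductionAt v := (hasGoodReductionAtPrime_primesEquiv_iff_holds W v ℓ hvℓ).mp hgoodℓ
  -- the reduction `Ẽ_v / k`, an elliptic curve over the residue field `k` with `ℓ` elements, `tr = a_ℓ`
  set k := IsLocalRing.ResidueField (v.adicCompletionIntegers ℚ) with hk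
  letI : Fintype k := Fintype.ofFinite k
  set Wt : WeierstrassCurve k := W.reductionAt v with hWt
  haveI : Wt.IsElliptic := isElliptic_reductionAt hgood
  have hcardk : Fintype.card k = ℓ := by
    rw [← Nat.card_eq_fintype_card, natCard_residueField_adicCompletionIntegers v, hvℓ]
  have hcardWt : Nat.card Wt.toAffine.Point = W.reductionPointCount ℓ := by
    rw [← hvℓ]
    exact natCard_point_reduction_minimal_baseChange v W
  have htr : HasseManin.tr Wt = W.frobeniusTrace ℓ := by rw [HasseManin.tr, hcardk, hcardWt, frobeniusTrace]
  -- Step 1: a Frobenius `σ₀ ∈ Γ_ℚ` at `ℓ` and the reduction map on `p`-primary torsion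
  obtain ⟨𝔐, h𝔐⟩ := v.localPrimesAbove_nonempty
  let ι : AlgebraicClosure ℚ →ₐ[ℚ] AlgebraicClosure (v.adicCompletion ℚ) := closureEmb (K := ℚ) (v.adicCompletion ℚ)
  obtain ⟨σL, hσL⟩ := v.exists_isArithFrobAt_localAbsIntegers h𝔐
  obtain ⟨φk, hφk⟩ := exists_frobenius_absoluteGaloisGroup k
  obtain ⟨f, hf, hfσ⟩ := exists_reduceTorsionHom hpv hgood h𝔐 ι hσL hφk
  set σ₀ : absoluteGaloisGroup ℚ := resGalOfEmb ι σL with hσ₀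
  -- Step 2: Manin's relation pulled back along `f`: `σ₀²P − a_ℓ σ₀P + ℓP = O` on `E[p^∞]`
  have hrel : ∀ (P : geomPoints W) (n : ℕ), p ^ n • P = 0 →
      σ₀ • (σ₀ • P) - W.frobeniusTrace ℓ • (σ₀ • P) + (ℓ : ℤ) • P = 0 := by
    intro P n hP
    obtain ⟨P', hP'⟩ : ∃ P' : geomPrimaryTorsion W p, (P' : geomPoints W) = P := ⟨⟨P, n, hP⟩, rfl⟩
    have hmanin := Wt.frobenius_sq_sub_trace_smul_add_card_smul hφk (f P')
    rw [htr, hcardk, ← hfσ, ← hfσ, ← map_zsmul, ← map_zsmul, ← map_sub, ← map_add, ← f.map_zero] at hmanin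
    have hrel' : σ₀ • (σ₀ • P') - W.frobeniusTrace ℓ • (σ₀ • P') + (ℓ : ℤ) • P' = 0 := hf hmanin
    have h := congrArg Subtype.val hrel'
    simp only [AddSubgroupClass.coe_sub, AddMemClass.coe_add, primaryComponent.coe_smul, ZeroMemClass.coe_zero, hP'] at h
    exact h
  -- scalars divisible by `p` kill `E[p]`; `E[p]` is stable under `σ₀` and under integer multiples
  have hpfix : ∀ y : geomPoints W, p • y = 0 → ∀ z : ℤ, (p : ℤ) ∣ z → z • y = 0 := by
    rintro y hy z ⟨e, rfl⟩
    rw [mul_comm, mul_zsmul, natCast_zsmul, hy, zsmul_zero]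
  have hpσ : ∀ y : geomPoints W, p • y = 0 → p • (σ₀ • y) = 0 := fun y hy ↦ by rw [smul_comm, hy, smul_zero]
  have hpz : ∀ y : geomPoints W, p • y = 0 → ∀ z : ℤ, p • (z • y) = 0 := fun y hy z ↦ by
    rw [smul_comm, hy, zsmul_zero]
  -- congruent scalars act alike on `E[p]`
  have hcong : ∀ y : geomPoints W, p • y = 0 → ∀ z z' : ℤ, (p : ℤ) ∣ z - z' → z • y = z' • y := fun y hy z z' h ↦ by
    have := hpfix y hy _ h
    rwa [sub_smul, sub_eq_zero] at this
  -- (A) on `E[p]`: `(σ₀ − c)² = 0`, i.e. `σ₀ (σ₀ y − c y) = c (σ₀ y − c y)`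
  have hA : ∀ y : geomPoints W, p • y = 0 → σ₀ • (σ₀ • y - c • y) = c • (σ₀ • y - c • y) := by
    intro y hy
    have h2 : W.frobeniusTrace ℓ • (σ₀ • y) = (2 * c) • (σ₀ • y) := hcong _ (hpσ y hy) _ _ ha
    have h3 : (ℓ : ℤ) • y = (c ^ 2) • y := hcong y hy _ _ hc
    have h1 := hrel y 1 (by rwa [pow_one])
    rw [h2, h3] at h1
    rw [smul_sub, smul_comm σ₀ c y, ← sub_eq_zero, ← h1]
    generalize σ₀ • (σ₀ • y) = X
    generalize σ₀ • y = Y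
    module
  -- the normalised nilpotent part `N y := d (σ₀ y − c y)`
  obtain ⟨N, hN⟩ : ∃ N : geomPoints W → geomPoints W, ∀ y, N y = d • (σ₀ • y - c • y) := ⟨_, fun _ ↦ rfl⟩
  have hNp : ∀ y : geomPoints W, p • y = 0 → p • N y = 0 := fun y hy ↦ by
    rw [hN, smul_comm, nsmul_sub, hpσ y hy, hpz y hy, sub_self, smul_zero]
  have hσN : ∀ y : geomPoints W, p • y = 0 → σ₀ • N y = c • N y := fun y hy ↦ by
    rw [hN, smul_comm σ₀ d, hA y hy, smul_comm c d]
  have hσy : ∀ y : geomPoints W, p • y = 0 → σ₀ • y = c • (y + N y) := fun y hy ↦ by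
    have h : (c * d) • (σ₀ • y - c • y) = (1 : ℤ) • (σ₀ • y - c • y) := by
      refine hcong _ ?_ _ _ hcd
      rw [nsmul_sub, hpσ y hy, hpz y hy, sub_self]
    rw [one_smul, mul_zsmul] at h
    rw [hN, smul_add, h]
    abel
  have hpow : ∀ y : geomPoints W, p • y = 0 → ∀ n : ℕ, σ₀ ^ n • y = (c ^ n) • (y + n • N y) := by
    intro y hy n
    induction n with
    | zero => simp only [pow_zero, one_smul, zero_smul, add_zero]
    | succ n ih =>
        rw [pow_succ', mul_smul, ih, smul_comm σ₀ (c ^ n), smul_add, smul_comm σ₀ n (N y), hσN y hy, hσy y hy,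
          pow_succ, succ_nsmul]
        generalize N y = Z
        module
  -- (B) `σ₀ ≠ c` on `E[p]` (else a point of order `p²` forces `p² ∣ c² − a_ℓ c + ℓ`)
  obtain ⟨e, Φ, he, -, -, -, -⟩ := exists_frame_galoisRepTorsion_rat W p
  have hB : ∃ y : geomPoints W, p • y = 0 ∧ σ₀ • y ≠ c • y := by
    by_contra hnone
    push Not at hnone
    obtain ⟨w, hw⟩ := exists_ne (0 : Fin 2 → ZMod p)
    have hx0 : e.symm w ≠ 0 := fun h ↦ hw (by simpa using congrArg e h)
    have hxp : p • (e.symm w : geomPoints W) = 0 := by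
      have h := (mem_torsionPoints_iff _ _ (e.symm w : geomPoints W)).mp (e.symm w).2
      rwa [natCast_zsmul] at h
    obtain ⟨P, hP⟩ := W.zsmul_geomPoints_surjective_of_charZero (n := (p : ℤ)) (by exact_mod_cast hp.ne_zero)
      (e.symm w : geomPoints W)
    have hPp : p • P = (e.symm w : geomPoints W) := by rw [← natCast_zsmul]; exact hP
    have hP2 : p ^ 2 • P = 0 := by rw [pow_two, mul_nsmul, hPp, hxp]
    obtain ⟨Q, hQ⟩ : ∃ Q : geomPoints W, Q = σ₀ • P - c • P := ⟨_, rfl⟩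
    have hQp : p • Q = 0 := by
      rw [hQ, nsmul_sub, smul_comm p σ₀ P, smul_comm p c P, hPp, hnone _ hxp, sub_self]
    have hσQ : σ₀ • Q = c • Q := hnone Q hQp
    have hσP : σ₀ • P = c • P + Q := by rw [hQ]; abel
    have hσσP : σ₀ • (σ₀ • P) = (c * c) • P + (2 * c) • Q := by
      rw [hσP, smul_add, hσQ, smul_comm σ₀ c P, hσP]
      module
    have haQ : W.frobeniusTrace ℓ • Q = (2 * c) • Q := hcong Q hQp _ _ ha
    have hM := hrel P 2 hP2
    rw [hσσP, hσP, smul_add, haQ] at hM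
    have hord : (c ^ 2 - W.frobeniusTrace ℓ * c + ℓ) • P = 0 := by
      rw [← hM]
      module
    have hordP : addOrderOf P = p ^ 2 := by
      obtain ⟨j, hj, hjP⟩ := (Nat.dvd_prime_pow hp).mp (addOrderOf_dvd_of_nsmul_eq_zero hP2)
      interval_cases j
      · exfalso; apply hx0
        rw [pow_zero, AddMonoid.addOrderOf_eq_one_iff] at hjP
        exact Subtype.ext (by rw [← hPp, hjP, smul_zero, ZeroMemClass.coe_zero])
      · exfalso; apply hx0
        have h1 : p • P = 0 := by simpa [hjP] using addOrderOf_nsmul_eq_zero P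
        exact Subtype.ext (by rw [← hPp, h1, ZeroMemClass.coe_zero])
      · exact hjP
    have hdvd : ((p ^ 2 : ℕ) : ℤ) ∣ c ^ 2 - W.frobeniusTrace ℓ * c + ℓ := by
      rw [← hordP]; exact addOrderOf_dvd_iff_zsmul_eq_zero.mpr hord
    exact hp2 (by exact_mod_cast hdvd)
  -- some `y ∈ E[p]` with `N y ≠ 0`
  obtain ⟨y₀, hy₀, hNy₀⟩ : ∃ y : geomPoints W, p • y = 0 ∧ N y ≠ 0 := by
    obtain ⟨y, hy, hσ⟩ := hB
    refine ⟨y, hy, fun h ↦ hσ ?_⟩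
    rw [hσy y hy, h, add_zero]
  -- (C) `h = ρ̄(σ₀)^(p-1)` acts on `E[p]` as `y ↦ y − N y`; `h ^ p = 1`, `h ≠ 1`, so `p ∣ #ρ̄(Γ_ℚ)` — Serre Prop. 15
  have hh : ∀ y : geomPoints W, p • y = 0 → σ₀ ^ (p - 1) • y = y - N y := by
    intro y hy
    rw [hpow y hy (p - 1), hcong _ (by rw [smul_add, hy, smul_comm, hNp y hy, smul_zero, zero_add]) _ 1 hF, one_smul]
    have hp1 : (p - 1) • N y = p • N y - N y := by
      have h := succ_nsmul (N y) (p - 1)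
      rw [Nat.sub_add_cancel hp.one_le] at h
      rw [h, add_sub_cancel_right]
    rw [hp1, hNp y hy, zero_sub]
    abel
  have hhp : ∀ y : geomPoints W, p • y = 0 → σ₀ ^ ((p - 1) * p) • y = y := by
    intro y hy
    have hFp : (p : ℤ) ∣ c ^ ((p - 1) * p) - 1 := by
      have h1 := sub_dvd_pow_sub_pow (c ^ (p - 1)) 1 p
      rw [one_pow, ← pow_mul] at h1
      exact hF.trans h1
    rw [hpow y hy, mul_nsmul, smul_comm p (p - 1) (N y), hNp y hy, smul_zero, add_zero, hcong y hy _ 1 hFp,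
      one_smul]
  have hgp : galoisRepTorsion W p (σ₀ ^ (p - 1)) ^ p = 1 := by
    rw [← map_pow, ← pow_mul]
    refine Multiplicative.toAdd.injective (AddEquiv.ext fun P ↦ ?_)
    rw [galoisRepTorsion_apply]
    have hPp : p • (P : geomPoints W) = 0 := by
      have h := (mem_torsionPoints_iff _ _ (P : geomPoints W)).mp P.2
      rwa [natCast_zsmul] at h
    apply Subtype.ext
    rw [AddSubgroup.torsionBy.coe_smul, hhp _ hPp]
    rfl
  have hg1 : galoisRepTorsion W p (σ₀ ^ (p - 1)) ≠ 1 := by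
    intro h1
    have hyp : ((p : ℕ) : ℤ) • y₀ = 0 := by rw [natCast_zsmul]; exact hy₀
    have h := galoisRepTorsion_apply W p (σ₀ ^ (p - 1)) ⟨y₀, (mem_torsionPoints_iff _ _ _).mpr hyp⟩
    rw [h1] at h
    have h' : σ₀ ^ (p - 1) • y₀ = y₀ := (congrArg Subtype.val h).symm
    rw [hh y₀ hy₀, sub_eq_self] at h'
    exact hNy₀ h'
  set G : Subgroup (GL (Fin 2) (ZMod p)) := (galoisRepTorsion W p).range.map Φ.toMonoidHom with hG
  have hGtop : G ≠ ⊤ := fun h ↦ hns ((map_range_galoisRepTorsion_eq_top_iff W p Φ).mp h)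
  have hdetG : ∀ u : (ZMod p)ˣ, ∃ g ∈ G, Matrix.GeneralLinearGroup.det g = u := exists_mem_map_range_det_eq W p Φ e he
  have hirrG : ∀ (u : Fin 2 → ZMod p) (hu : u ≠ 0), ¬ G ≤ eigenvectorStabilizer u hu :=
    fun u hu ↦ not_le_eigenvectorStabilizer_of_hasIrreducibleModPGaloisRep W p Φ e he hirr hu
  have hcard : ¬ p ∣ Nat.card G := Serre1972.not_dvd_natCard_of_forall_not_le_eigenvectorStabilizer G hdetG hGtop hirrG
  have horder : orderOf (Φ (galoisRepTorsion W p (σ₀ ^ (p - 1)))) = p := by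
    refine orderOf_eq_prime ?_ fun h ↦ hg1 (Φ.injective (h.trans (map_one Φ).symm))
    rw [← map_pow, hgp, map_one]
  have hdvdG := Subgroup.orderOf_dvd_natCard G (apply_galoisRepTorsion_mem_map_range W p Φ (σ₀ ^ (p - 1)))
  rw [horder] at hdvdG
  exact hcard hdvdG

end Summit.BirchSwinnertonDyer.BirchSwinnertonDyer.Rank2Observatory

end
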